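import Literature.NumberTheory.Automorphic.Liu2021.LemD1FamilyOfPlace
import Literature.NumberTheory.Automorphic.UnitaryGroupNonsplitPlace
import Literature.NumberTheory.GelbartRogawski1991.CMSplittingCharLocalMu
import Literature.NumberTheory.GaloisRepresentations.CMTypeHeckeCharacter
import Literature.RepresentationTheory.Liu2021.OscillatorConventions
import Literature.NumberTheory.Automorphic.ConjugateSelfDualCharacters
import Literature.NumberTheory.Automorphic.IdeleClassCharacterHecke
import HarnessLib

/-!
# [Liu2021, App. D §D.1 Step 2 ∕ Lemma D.1 (3)] — RIGIDITY of unramified Step-2 characters at an INERT place of the place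
# model: there is exactly one; the CM rows' μ-labels `localMu L (toHeckeCharacter L ψ) v` COINCIDE across `ψ` there

Reproduction ∕ bookkeeping (Literature, THEOREMS ONLY: no definition, no record, no named fact, no `sorry`; nothing is
asserted about Liu's oscillator representations or about the tree's constructed local Weil carriers).

Sequel of `LemD1AsPrintedIndexedNonVacuityPlaceDichotomy.lean` (at an unramified non-split place the rows' own `μ_v` is quadratic,
`μ_v³ = μ_v`).  Setting: the tree's place model of a quadratic extension `E/F` of number fields at a finite place `v`
(`F_v = v.adicCompletion F`, `E_v = UnitaryGroup.LocalRing E v`, `c ⊗ 1 = conjLocal`), a place `w ∣ v` FIXED by `c` (non-split), and an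
INERT WITNESS `π ∈ F_vˣ` with `v_w(ι_w π) = exp(−1)` — a uniformiser of `F_v` that is a uniformiser of `E_w`, i.e. `w ∣ v` unramified
(this holds at all but finitely many non-split places; the hypothesis is carried explicitly, nothing about ramification indices is used):

* §1 `valued_mul_conjLocal_apply`: a norm `x · (c ⊗ 1) x` has `w`-valuation `v_w(x_w)²` (`((c ⊗ 1) x)_w = c_w(x_w)` and `c_w` preserves
  `v_w`, tree `valued_galAdicCompletionMap`); `not_isNorm_of_valued_eq`: `ι_v π` is NOT a norm (odd versus even valuation);
* §2 `stepTwo_apply_eq_neg_one_of_valued_eq`: EVERY Step-2 datum `(μ, hμF)` (the rows' displayed binder shape) has `μ(ι_v π) = −1`;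
  **`stepTwo_eq_of_unramified`** (RIGIDITY): two Step-2 data which are both UNRAMIFIED — trivial on the units `u ∈ E_vˣ` with
  `v_w(u_w) = 1` — are EQUAL, because `E_vˣ ∋ x = (ι_v π)^{−m} · u` with `exp(m) = v_w(x_w)` (`valued_mul_zpow_apply_eq_one`); explicitly
  **`stepTwo_apply_eq_neg_one_zpow`**: `μ(x) = (−1)^m` — an unramified Step-2 character at an inert place IS the unramified sign character
  `x ↦ (−1)^{ord_w x_w}`; `muSet_eq_of_unramified`: the `MuSet` form (the printed Step-2 index set has exactly one unramified element there);
* §3 the CM rows (`L` CM, `F = L⁺`, `c` = complex conjugation): for conjugate symplectic `ψ, ψ'` whose Hecke characters are unramified at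
  the `w` over an inert `v`, **`localMu_eq_localMu_of_inert_of_isUnramifiedAt`**: `localMu L (toHeckeCharacter L ψ) v =
  localMu L (toHeckeCharacter L ψ') v` (both `= (−1)^{ord_w}`, `localMu_apply_eq_neg_one_zpow_of_inert_of_isUnramifiedAt`), hence
  **`muOf_localMu_eq_of_inert_of_isUnramifiedAt`**: the packaged `μ`-labels of two members of the displayed `hD3` family (indexed by
  `ψ`) COINCIDE at such a place — there the `μ`-conjunct of [Lem. D.1 (3)] AS PRINTED cannot distinguish ANY two members (not only `μ`
  from `μ³`, `…PlaceDichotomy` §2), and (3) reads «`ω_i ≅ ω_j ↔ ε_i ∼ ε_j ∧ χ_i = χ_j`» on the labels.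

What this does NOT give: the ramified non-split places (there `E_wˣ/(ι_v F_vˣ · 𝒪_wˣ)` has order `2` and two unramified Step-2
characters may differ by the sign of `μ(ϖ_w)`); the existence of an unramified Step-2 character at a GENERAL (non-CM) `E/F` (for the CM
rows it is `μ_v` itself at almost every place); that inert witnesses exist at all but finitely many non-split places (ramification in
`L/L⁺` is finite — not formalised here); anything about the rows' carriers; Lem. D.1 itself.  HC_CM is NOT proved.

Cell pub-hodgecm2 (COR-CM), audit class of the END rows `hD1''` ∕ `hD3`; seat prover-pub-hodgecm2-b10.

References: [Liu2021] Y. Liu, *Fourier–Jacobi cycles and arithmetic relative trace formula*, Camb. J. Math. 9 (2021) =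
arXiv:2102.11518, Def. 4.1, Def. 4.11 (l. 2086), App. D §D.1 Step 2 (l. 5219), Lemma D.1 (3) (l. 5233);
[CasselsFrohlichANT1967] Ch. II §10 (completions of a quadratic extension; valuations under the Galois action), Ch. VII Prop. 1.2.
-/

noncomputable section

open scoped Matrix MatrixGroups
open NumberField IsDedekindDomain
open Literature.RepresentationTheory
open Literature.NumberTheory.GaloisRepresentations (HeckeCharacter localUnits)

namespace Literature.NumberTheory.Automorphic.Liu2021.LemD1IndexedNonVacuityInertRigidity

open UnitaryGroup

section General

variable {F : Type} (E : Type) [Field F] [NumberField F] [Field E] [NumberField E] [Algebra F E]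
  [Algebra.IsQuadraticExtension F E] (v : HeightOneSpectrum (𝓞 F)) (c : E ≃ₐ[F] E)
  {δ : E} (hcδ : c δ = -δ) (hδ : δ ≠ 0)

/-! ## §1 Valuations at a non-split place: norms have even valuation; an element of odd valuation is not a norm -/

omit [NumberField F] [Algebra.IsQuadraticExtension F E] in
include hcδ hδ in
/-- `c ≠ 1`. [folklore] -/
private theorem hc_of_delta : c ≠ 1 := by
  rintro rfl
  rw [AlgEquiv.one_apply] at hcδ
  have h2 : (2 : E) * δ = 0 := by linear_combination hcδ
  exact hδ ((mul_eq_zero.mp h2).resolve_left two_ne_zero)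

include hcδ hδ in
/-- `((c ⊗ 1) x)_w = c_w(x_w)` at a non-split place (`w` is the only place above `v`). [cite: CasselsFrohlichANT1967, Ch. II §10] -/
private theorem conjLocal_apply_of_smul_eq (w : PlacesOver E v) (hw : c • w.1 = w.1) (x : LocalRing E v) :
    conjLocal E c v x w = galAdicCompletionMap c hw (x w) := by
  have key : ∀ (w₁ : PlacesOver E v) (h₁ : c • w₁.1 = w.1),
      galAdicCompletionMap c h₁ (x w₁) = galAdicCompletionMap c hw (x w) := by
    intro w₁ h₁
    have e : w₁ = w := PlacesOver.eq_of_smul_eq c (hc_of_delta E c hcδ hδ) w hw w₁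
    subst e
    rfl
  rw [conjLocal_apply]
  exact key ⟨c⁻¹ • w.1, under_inv_smul_eq c w⟩ (smul_inv_smul c w.1)

include hcδ hδ in
/-- **at a non-split place a norm `x · (c ⊗ 1) x` has EVEN valuation**: `v_w((x · (c ⊗ 1) x)_w) = v_w(x_w)²` (`c_w` preserves `v_w`).
[cite: CasselsFrohlichANT1967, Ch. II §10] -/
theorem valued_mul_conjLocal_apply (w : PlacesOver E v) (hw : c • w.1 = w.1) (x : LocalRing E v) :
    Valued.v ((x * conjLocal E c v x) w) = Valued.v (x w) ^ 2 := by
  rw [Pi.mul_apply, map_mul, conjLocal_apply_of_smul_eq E v c hcδ hδ w hw, valued_galAdicCompletionMap, sq]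

include hcδ hδ in
/-- **an element of `F_vˣ` whose image in `E_w` has valuation `exp(−1)` is NOT a norm from `E_vˣ`** at a non-split place (odd versus
even valuation) — e.g. a uniformiser of `F_v` at a place INERT in `E` (unramified, non-split: a uniformiser of `F_v` stays one of `E_w`).
[cite: Liu2021, App. D §D.1 Step 2 (l. 5219)] [cite: CasselsFrohlichANT1967, Ch. II §10] -/
theorem not_isNorm_of_valued_eq (w : PlacesOver E v) (hw : c • w.1 = w.1) (π : (v.adicCompletion F)ˣ)
    (hπ : Valued.v (toPlace v w (π : v.adicCompletion F)) = WithZero.exp (-1 : ℤ)) :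
    ¬ ∃ x : (LocalRing E v)ˣ, (x : LocalRing E v) * conjLocal E c v x = algebraMap (v.adicCompletion F) (LocalRing E v) π := by
  rintro ⟨x, hx⟩
  have h : Valued.v (((x : LocalRing E v) * conjLocal E c v x) w) =
      Valued.v ((algebraMap (v.adicCompletion F) (LocalRing E v) (π : v.adicCompletion F)) w) := by rw [hx]
  rw [valued_mul_conjLocal_apply E v c hcδ hδ w hw, algebraMap_localRing_eq, toLocalRing_apply, hπ] at h
  have hx0 : Valued.v ((x : LocalRing E v) w) ≠ 0 :=
    (Valuation.ne_zero_iff _).2 fun h0 => by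
      rw [h0, map_zero, zero_pow two_ne_zero] at h
      exact WithZero.exp_ne_zero h.symm
  rw [← WithZero.exp_log hx0, sq, ← WithZero.exp_add] at h
  have h' := congrArg WithZero.log h
  rw [WithZero.log_exp, WithZero.log_exp] at h'
  omega

/-! ## §2 Step-2 data at a non-split place with an inert witness: `μ(ι_v π) = −1`, and RIGIDITY of the unramified ones -/

omit [Algebra.IsQuadraticExtension F E] in
/-- `ι_v(a) · (c ⊗ 1)(ι_v a) = ι_v(a²)`. [cite: Liu2021, App. D §D.1 Step 2 (l. 5219)] -/
private theorem units_map_mul_conjLocal (a : (v.adicCompletion F)ˣ) :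
    ((Units.map (algebraMap (v.adicCompletion F) (LocalRing E v)).toMonoidHom a : (LocalRing E v)ˣ) : LocalRing E v) *
        conjLocal E c v (Units.map (algebraMap (v.adicCompletion F) (LocalRing E v)).toMonoidHom a : (LocalRing E v)ˣ) =
      algebraMap (v.adicCompletion F) (LocalRing E v) ((a * a : (v.adicCompletion F)ˣ) : v.adicCompletion F) := by
  rw [Units.coe_map, RingHom.toMonoidHom_eq_coe, MonoidHom.coe_coe, algebraMap_localRing_eq, conjLocal_toLocalRing,
    Units.val_mul, map_mul]

include hcδ hδ in
/-- **every Step-2 datum takes the value `−1` at an inert witness**: for `μ : E_vˣ → ℂˣ` satisfying the printed clause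
«`μ(ι_v a) = 1 ↔ a ∈ Nm E_vˣ`» and `π ∈ F_vˣ` with `v_w(ι_w π) = exp(−1)`: `μ(ι_v π) = −1` (`≠ 1` by §1, square `1` since `π²` is a norm).
[cite: Liu2021, App. D §D.1 Step 2 (l. 5219)] -/
theorem stepTwo_apply_eq_neg_one_of_valued_eq (w : PlacesOver E v) (hw : c • w.1 = w.1) (π : (v.adicCompletion F)ˣ)
    (hπ : Valued.v (toPlace v w (π : v.adicCompletion F)) = WithZero.exp (-1 : ℤ)) (μ : (LocalRing E v)ˣ →* ℂˣ)
    (hμF : ∀ a : (v.adicCompletion F)ˣ,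
      μ (Units.map (algebraMap (v.adicCompletion F) (LocalRing E v)).toMonoidHom a) = 1 ↔
        ∃ x : (LocalRing E v)ˣ, (x : LocalRing E v) * conjLocal E c v x =
          algebraMap (v.adicCompletion F) (LocalRing E v) a) :
    μ (Units.map (algebraMap (v.adicCompletion F) (LocalRing E v)).toMonoidHom π) = -1 := by
  have hne : μ (Units.map (algebraMap (v.adicCompletion F) (LocalRing E v)).toMonoidHom π) ≠ 1 :=
    fun h => not_isNorm_of_valued_eq E v c hcδ hδ w hw π hπ ((hμF π).1 h)
  have hsq : μ (Units.map (algebraMap (v.adicCompletion F) (LocalRing E v)).toMonoidHom π) ^ 2 = 1 := by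
    rw [sq, ← map_mul, ← map_mul]
    exact (hμF (π * π)).2 ⟨_, units_map_mul_conjLocal E v c π⟩
  have h2 : (((μ (Units.map (algebraMap (v.adicCompletion F) (LocalRing E v)).toMonoidHom π) : ℂˣ) : ℂ)) ^ 2 = 1 := by
    rw [← Units.val_pow_eq_pow_val, hsq, Units.val_one]
  rcases sq_eq_one_iff.1 h2 with h | h
  · exact absurd (Units.ext h) hne
  · exact Units.ext (by rw [h, Units.val_neg, Units.val_one])

omit [Algebra.IsQuadraticExtension F E] in
/-- the `w`-component of `x · (ι_v π)^m` has valuation `1` when `v_w(x_w) = exp(m)` and `v_w(ι_w π) = exp(−1)`.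
[cite: CasselsFrohlichANT1967, Ch. II §10] -/
private theorem valued_mul_zpow_apply_eq_one (w : PlacesOver E v) (π : (v.adicCompletion F)ˣ)
    (hπ : Valued.v (toPlace v w (π : v.adicCompletion F)) = WithZero.exp (-1 : ℤ)) (x : (LocalRing E v)ˣ) :
    Valued.v (((x * Units.map (algebraMap (v.adicCompletion F) (LocalRing E v)).toMonoidHom π ^
        WithZero.log (Valued.v ((x : LocalRing E v) w)) : (LocalRing E v)ˣ) : LocalRing E v) w) = 1 := by
  set m : ℤ := WithZero.log (Valued.v ((x : LocalRing E v) w)) with hm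
  let prw : (LocalRing E v)ˣ →* (w.1.adicCompletion E)ˣ :=
    Units.map (Pi.evalRingHom (fun w' : PlacesOver E v => w'.1.adicCompletion E) w).toMonoidHom
  have hprw : ∀ y : (LocalRing E v)ˣ, ((prw y : (w.1.adicCompletion E)ˣ) : w.1.adicCompletion E) = (y : LocalRing E v) w :=
    fun y => rfl
  have hx0 : Valued.v ((x : LocalRing E v) w) ≠ 0 := by
    rw [← hprw]
    exact (Valuation.ne_zero_iff _).2 (prw x).ne_zero
  have hP : Valued.v ((prw (Units.map (algebraMap (v.adicCompletion F) (LocalRing E v)).toMonoidHom π) :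
      (w.1.adicCompletion E)ˣ) : w.1.adicCompletion E) = WithZero.exp (-1 : ℤ) := by
    rw [hprw, Units.coe_map, RingHom.toMonoidHom_eq_coe, MonoidHom.coe_coe, algebraMap_localRing_eq, toLocalRing_apply, hπ]
  rw [← hprw, map_mul, map_zpow, Units.val_mul, Units.val_zpow_eq_zpow_val, map_mul, map_zpow₀, hP, ← WithZero.exp_zsmul,
    hprw, ← WithZero.exp_log hx0, ← hm, ← WithZero.exp_add, smul_eq_mul, mul_neg, mul_one, add_neg_cancel, WithZero.exp_zero]

include hcδ hδ in
/-- **RIGIDITY of unramified Step-2 characters at an inert place**: at a non-split place `w ∣ v` with an inert witness `π ∈ F_vˣ`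
(`v_w(ι_w π) = exp(−1)`: a uniformiser of `F_v` is a uniformiser of `E_w`), two Step-2 data `μ, μ'` of the place model (printed clause
«`μ(ι_v a) = 1 ↔ a ∈ Nm E_vˣ`») which are both UNRAMIFIED (trivial on the units of `w`-valuation `1`) are EQUAL: `E_vˣ = ι_v(π)^ℤ · 𝒪_wˣ`
and `μ(ι_v π) = −1 = μ'(ι_v π)` (§2).  So at an inert place the printed Step-2 index set has EXACTLY ONE unramified element.
[cite: Liu2021, App. D §D.1 Step 2 (l. 5219)] [cite: CasselsFrohlichANT1967, Ch. II §10] -/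
theorem stepTwo_eq_of_unramified (w : PlacesOver E v) (hw : c • w.1 = w.1) (π : (v.adicCompletion F)ˣ)
    (hπ : Valued.v (toPlace v w (π : v.adicCompletion F)) = WithZero.exp (-1 : ℤ)) (μ μ' : (LocalRing E v)ˣ →* ℂˣ)
    (hμF : ∀ a : (v.adicCompletion F)ˣ,
      μ (Units.map (algebraMap (v.adicCompletion F) (LocalRing E v)).toMonoidHom a) = 1 ↔
        ∃ x : (LocalRing E v)ˣ, (x : LocalRing E v) * conjLocal E c v x =
          algebraMap (v.adicCompletion F) (LocalRing E v) a)
    (hμ'F : ∀ a : (v.adicCompletion F)ˣ,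
      μ' (Units.map (algebraMap (v.adicCompletion F) (LocalRing E v)).toMonoidHom a) = 1 ↔
        ∃ x : (LocalRing E v)ˣ, (x : LocalRing E v) * conjLocal E c v x =
          algebraMap (v.adicCompletion F) (LocalRing E v) a)
    (hμu : ∀ u : (LocalRing E v)ˣ, Valued.v ((u : LocalRing E v) w) = 1 → μ u = 1)
    (hμ'u : ∀ u : (LocalRing E v)ˣ, Valued.v ((u : LocalRing E v) w) = 1 → μ' u = 1) : μ = μ' := by
  ext x
  set P : (LocalRing E v)ˣ := Units.map (algebraMap (v.adicCompletion F) (LocalRing E v)).toMonoidHom π with hPdef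
  set m : ℤ := WithZero.log (Valued.v ((x : LocalRing E v) w)) with hm
  have hu := valued_mul_zpow_apply_eq_one E v w π hπ x
  rw [← hPdef, ← hm] at hu
  have h1 : μ (x * P ^ m) = 1 := hμu _ hu
  have h2 : μ' (x * P ^ m) = 1 := hμ'u _ hu
  have hP1 : μ P = -1 := stepTwo_apply_eq_neg_one_of_valued_eq E v c hcδ hδ w hw π hπ μ hμF
  have hP2 : μ' P = -1 := stepTwo_apply_eq_neg_one_of_valued_eq E v c hcδ hδ w hw π hπ μ' hμ'F
  rw [map_mul, map_zpow, hP1] at h1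
  rw [map_mul, map_zpow, hP2] at h2
  have e1 : μ x = ((-1 : ℂˣ) ^ m)⁻¹ := eq_inv_of_mul_eq_one_left h1
  have e2 : μ' x = ((-1 : ℂˣ) ^ m)⁻¹ := eq_inv_of_mul_eq_one_left h2
  rw [e1, e2]

include hcδ hδ in
/-- **… with the explicit value `μ(x) = (−1)^{m}`, `exp(m) = v_w(x_w)`**: at an inert place an unramified Step-2 character IS the
unramified sign character `x ↦ (−1)^{ord_w x_w}`. [cite: Liu2021, App. D §D.1 Step 2 (l. 5219)] -/
theorem stepTwo_apply_eq_neg_one_zpow (w : PlacesOver E v) (hw : c • w.1 = w.1) (π : (v.adicCompletion F)ˣ)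
    (hπ : Valued.v (toPlace v w (π : v.adicCompletion F)) = WithZero.exp (-1 : ℤ)) (μ : (LocalRing E v)ˣ →* ℂˣ)
    (hμF : ∀ a : (v.adicCompletion F)ˣ,
      μ (Units.map (algebraMap (v.adicCompletion F) (LocalRing E v)).toMonoidHom a) = 1 ↔
        ∃ x : (LocalRing E v)ˣ, (x : LocalRing E v) * conjLocal E c v x =
          algebraMap (v.adicCompletion F) (LocalRing E v) a)
    (hμu : ∀ u : (LocalRing E v)ˣ, Valued.v ((u : LocalRing E v) w) = 1 → μ u = 1) (x : (LocalRing E v)ˣ) :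
    μ x = (-1 : ℂˣ) ^ WithZero.log (Valued.v ((x : LocalRing E v) w)) := by
  set P : (LocalRing E v)ˣ := Units.map (algebraMap (v.adicCompletion F) (LocalRing E v)).toMonoidHom π with hPdef
  set m : ℤ := WithZero.log (Valued.v ((x : LocalRing E v) w)) with hm
  have hu := valued_mul_zpow_apply_eq_one E v w π hπ x
  rw [← hPdef, ← hm] at hu
  have h1 : μ (x * P ^ m) = 1 := hμu _ hu
  rw [map_mul, map_zpow, stepTwo_apply_eq_neg_one_of_valued_eq E v c hcδ hδ w hw π hπ μ hμF] at h1
  rw [eq_inv_of_mul_eq_one_left h1, ← inv_zpow, inv_neg_one]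

variable (N : ℕ) (J : Matrix (Fin N) (Fin N) E) (hN : 2 ≤ N) (hJh : (J.map c)ᵀ = J) (hJdet : J.det ≠ 0)

/-- **`MuSet` form of the rigidity**: two unramified elements of the printed Step-2 index set of the place model at an inert place are
equal. [cite: Liu2021, App. D §D.1 Step 2 (l. 5219)] -/
theorem muSet_eq_of_unramified (w : PlacesOver E v) (hw : c • w.1 = w.1) (π : (v.adicCompletion F)ˣ)
    (hπ : Valued.v (toPlace v w (π : v.adicCompletion F)) = WithZero.exp (-1 : ℤ))
    (μ μ' : LemD1.MuSet (LemD1OfPlace.standingData E v c N J hcδ hδ hN hJh hJdet))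
    (hμu : ∀ u : (LocalRing E v)ˣ, Valued.v ((u : LocalRing E v) w) = 1 → μ.1 u = 1)
    (hμ'u : ∀ u : (LocalRing E v)ˣ, Valued.v ((u : LocalRing E v) w) = 1 → μ'.1 u = 1) : μ = μ' :=
  Subtype.ext (stepTwo_eq_of_unramified E v c hcδ hδ w hw π hπ μ.1 μ'.1 μ.2.2.2 μ'.2.2.2 hμu hμ'u)

end General

/-! ## §3 The CM rows: at an inert place where `ψ`, `ψ'` are unramified, the μ-labels `localMu L (toHeckeCharacter L ψ) v` and
`localMu L (toHeckeCharacter L ψ') v` COINCIDE -/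

section CM

open Literature.NumberTheory.GelbartRogawski1991.UnitaryDualPair (imagUnit complexConj_imagUnit imagUnit_ne_zero)
open Literature.NumberTheory.GelbartRogawski1991.UnitaryDualPair.LocalSplitting (localMu localMu_apply norm_localMu
  continuous_localMu localMu_toLocalRing_eq_one_iff)
open Literature.NumberTheory.Automorphic.IdeleClassGroup (toHeckeCharacter isUnitary_toHeckeCharacter IsConjugateSymplectic)
open Literature.RepresentationTheory.Liu2021 (isOscillatorChar_toHeckeCharacter_iff)

variable (L : Type) [Field L] [NumberField L] [IsCMField L]

local notation3 "cc" => (IsCMField.complexConj L)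
local notation3 "L⁺" => (↥(maximalRealSubfield L))

variable (v : HeightOneSpectrum (𝓞 (maximalRealSubfield L)))

/-- at a non-split place, an unramified `χ` makes `localMu L χ v` trivial on the units of `w`-valuation `1` (`localMu … v u = χ_w(u_w)`).
[cite: Liu2021, Def. 4.11 (l. 2086)] -/
private theorem localMu_eq_one_of_valued_eq_one (σ : L ≃ₐ[L⁺] L) (hσ : σ ≠ 1) (χ : HeckeCharacter L) (w : PlacesOver L v)
    (hw : σ • w.1 = w.1) (hunr : χ.IsUnramifiedAt w.1) (u : (LocalRing L v)ˣ) (hu : Valued.v ((u : LocalRing L v) w) = 1) :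
    localMu L χ v u = 1 := by
  rw [localMu_apply, PlacesOver.prod_eq_of_smul_eq σ hσ w hw]
  exact HeckeCharacter.isUnramifiedAt_iff_forall_valued_eq_one.1 hunr _ hu

/-- **At an INERT place of `L⁺` above which `ψ` and `ψ'` are unramified, the rows' μ-labels COINCIDE**: for conjugate symplectic `ψ, ψ'`,
a place `w ∣ v` fixed by complex conjugation with an inert witness `π ∈ L⁺_vˣ` (`v_w(ι_w π) = exp(−1)`) and `toHeckeCharacter ψ`,
`toHeckeCharacter ψ'` unramified at `w`: `localMu L (toHeckeCharacter L ψ) v = localMu L (toHeckeCharacter L ψ') v` (§2 rigidity: both are the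
unramified sign character).  So ACROSS THE WHOLE displayed `hD3` family (members indexed by `ψ`) the `μ`-conjunct of [Lem. D.1 (3)] AS PRINTED
is void at such places — not only for `μ` versus `μ³` (`LemD1IndexedNonVacuityPlaceDichotomy` §2). [cite: Liu2021, App. D §D.1 Step 2 (l. 5219), Lemma D.1 (3) (l. 5233); Def. 4.1] -/
theorem localMu_eq_localMu_of_inert_of_isUnramifiedAt (ψ ψ' : IdeleClassGroup L →ₜ* Circle) (hψ : IsConjugateSymplectic L ψ)
    (hψ' : IsConjugateSymplectic L ψ') (w : PlacesOver L v) (hw : cc • w.1 = w.1) (π : (v.adicCompletion L⁺)ˣ)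
    (hπ : Valued.v (toPlace v w (π : v.adicCompletion L⁺)) = WithZero.exp (-1 : ℤ))
    (hunr : (toHeckeCharacter L ψ).IsUnramifiedAt w.1) (hunr' : (toHeckeCharacter L ψ').IsUnramifiedAt w.1) :
    localMu L (toHeckeCharacter L ψ) v = localMu L (toHeckeCharacter L ψ') v :=
  stepTwo_eq_of_unramified L v cc (complexConj_imagUnit L) (imagUnit_ne_zero L) w hw π hπ _ _
    (fun t => localMu_toLocalRing_eq_one_iff L (toHeckeCharacter L ψ) v ((isOscillatorChar_toHeckeCharacter_iff ψ).mpr hψ) t)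
    (fun t => localMu_toLocalRing_eq_one_iff L (toHeckeCharacter L ψ') v ((isOscillatorChar_toHeckeCharacter_iff ψ').mpr hψ') t)
    (localMu_eq_one_of_valued_eq_one L v cc (IsCMField.complexConj_ne_one L) _ w hw hunr)
    (localMu_eq_one_of_valued_eq_one L v cc (IsCMField.complexConj_ne_one L) _ w hw hunr')

/-- **… explicitly: the rows' own `μ_v` at an inert unramified place IS the sign character `x ↦ (−1)^{ord_w x_w}`.**
[cite: Liu2021, App. D §D.1 Step 2 (l. 5219); Def. 4.1] -/
theorem localMu_apply_eq_neg_one_zpow_of_inert_of_isUnramifiedAt (ψ : IdeleClassGroup L →ₜ* Circle)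
    (hψ : IsConjugateSymplectic L ψ) (w : PlacesOver L v) (hw : cc • w.1 = w.1) (π : (v.adicCompletion L⁺)ˣ)
    (hπ : Valued.v (toPlace v w (π : v.adicCompletion L⁺)) = WithZero.exp (-1 : ℤ))
    (hunr : (toHeckeCharacter L ψ).IsUnramifiedAt w.1) (x : (LocalRing L v)ˣ) :
    localMu L (toHeckeCharacter L ψ) v x = (-1 : ℂˣ) ^ WithZero.log (Valued.v ((x : LocalRing L v) w)) :=
  stepTwo_apply_eq_neg_one_zpow L v cc (complexConj_imagUnit L) (imagUnit_ne_zero L) w hw π hπ _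
    (fun t => localMu_toLocalRing_eq_one_iff L (toHeckeCharacter L ψ) v ((isOscillatorChar_toHeckeCharacter_iff ψ).mpr hψ) t)
    (localMu_eq_one_of_valued_eq_one L v cc (IsCMField.complexConj_ne_one L) _ w hw hunr) x

variable (N : ℕ) (J : Matrix (Fin N) (Fin N) L) (hN : 2 ≤ N) (hJh : (J.map (IsCMField.complexConj L))ᵀ = J) (hJdet : J.det ≠ 0)

/-- **The packaged labels coincide**: `LemD1OfPlace.muOf (localMu … ψ …) = LemD1OfPlace.muOf (localMu … ψ' …)` (with the displayed proof
shapes) at an inert place where both are unramified — the `μ`-slot of the `hD3` family cannot distinguish members there. [cite: Liu2021, App. D §D.1 Step 2 (l. 5219), Lemma D.1 (3) (l. 5233)] -/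
theorem muOf_localMu_eq_of_inert_of_isUnramifiedAt (ψ ψ' : IdeleClassGroup L →ₜ* Circle) (hψ : IsConjugateSymplectic L ψ)
    (hψ' : IsConjugateSymplectic L ψ') (w : PlacesOver L v) (hw : cc • w.1 = w.1) (π : (v.adicCompletion L⁺)ˣ)
    (hπ : Valued.v (toPlace v w (π : v.adicCompletion L⁺)) = WithZero.exp (-1 : ℤ))
    (hunr : (toHeckeCharacter L ψ).IsUnramifiedAt w.1) (hunr' : (toHeckeCharacter L ψ').IsUnramifiedAt w.1) :
    LemD1OfPlace.muOf L v cc N J (complexConj_imagUnit L) (imagUnit_ne_zero L) hN hJh hJdet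
        (localMu L (toHeckeCharacter L ψ) v)
        (fun x => norm_localMu L (toHeckeCharacter L ψ) v (isUnitary_toHeckeCharacter L ψ) x)
        (continuous_localMu L (toHeckeCharacter L ψ) v)
        (fun t => localMu_toLocalRing_eq_one_iff L (toHeckeCharacter L ψ) v ((isOscillatorChar_toHeckeCharacter_iff ψ).mpr hψ) t) =
      LemD1OfPlace.muOf L v cc N J (complexConj_imagUnit L) (imagUnit_ne_zero L) hN hJh hJdet
        (localMu L (toHeckeCharacter L ψ') v)
        (fun x => norm_localMu L (toHeckeCharacter L ψ') v (isUnitary_toHeckeCharacter L ψ') x)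
        (continuous_localMu L (toHeckeCharacter L ψ') v)
        (fun t => localMu_toLocalRing_eq_one_iff L (toHeckeCharacter L ψ') v ((isOscillatorChar_toHeckeCharacter_iff ψ').mpr hψ') t) :=
  Subtype.ext (localMu_eq_localMu_of_inert_of_isUnramifiedAt L v ψ ψ' hψ hψ' w hw π hπ hunr hunr')

end CM

end Literature.NumberTheory.Automorphic.Liu2021.LemD1IndexedNonVacuityInertRigidity

end
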